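import Summits.CriticalPhenomena.PercolationContinuityZ3.Theorems.PercNearOneGluingNoHeavyLowerTailSahiC4CubeColourEvents
import Summits.CriticalPhenomena.PercolationContinuityZ3.Theorems.PercNearOneGluingNoHeavyLowerTailSahiC3CubeFive
import Summits.CriticalPhenomena.PercolationContinuityZ3.Theorems.PercNearOneGluingNoHeavyLowerTailSahiC4CubeFiveChunkA1
import Summits.CriticalPhenomena.PercolationContinuityZ3.Theorems.PercNearOneGluingNoHeavyLowerTailSahiC4CubeFiveChunkA2
import Summits.CriticalPhenomena.PercolationContinuityZ3.Theorems.PercNearOneGluingNoHeavyLowerTailSahiC4CubeFiveChunkB1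
import Summits.CriticalPhenomena.PercolationContinuityZ3.Theorems.PercNearOneGluingNoHeavyLowerTailSahiC4CubeFiveChunkB2
import Summits.CriticalPhenomena.PercolationContinuityZ3.Theorems.PercNearOneGluingNoHeavyLowerTailSahiC4CubeFiveChunkC
import Summits.CriticalPhenomena.PercolationContinuityZ3.Theorems.PercNearOneGluingNoHeavyLowerTailSahiC4CubeFiveChunkD

/-!
# Sahi's `C₄` on the cube `{0,1}^5` for EVERY product measure

Support file (cell `prim-sahi`, seat `prim-sahi-typer` gen 28; `--supports stmt-CriticalPhenomena-4575`).  Pure proofs here; the closure is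
COMPUTATIONAL through the `native_decide` chunks `colour4Chunk_five_a1/a2s/a2/b1/b2s/b2/c/d` (…`SahiC4CubeFiveChunk*`) and through
`SahiC3Cube.sahiC3_cube_five` (…`SahiC3CubeFive`, itself `native_decide`).

**Theorem `sahiC4_cube_five`.**  For every `p : Fin 5 → [0,1]` and all increasing events `A, B, C, D ⊆ Set (Fin 5)`:
`0 ≤ E₄(A,B,C,D) = 6μ(ABCD) − 2Σμ(A_i)μ(A_jA_kA_l) + Σμ(A_i)μ(A_j)μ(A_kA_l) − Σμ(A_iA_j)μ(A_kA_l) − μ(A)μ(B)μ(C)μ(D)`, `μ = prodBernoulli p` —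
Sahi's Conjecture 5 at order `n = 4` [Sahi 2008; Lieb–Sahi 2022, Def. 3.1] for five independent coins with arbitrary biases.  The tree had
`m ≤ 3` (kernel, …`SahiC4CubeLeThree`) and `m = 4` (`sahiC4_cube_four`, `native_decide` over the `82 093` non-absorbing sorted quadruples of the
`168` increasing bitmasks); at `m = 5` there are `7 581` increasing events and `≈ 1.4·10^14` sorted quadruples.  By the VALUE-LEVEL SATURATION
REDUCTION at order four (`SahiAbsorbed.sahiPositive_of_colouring`, given `C₁`, `C₂` and `C₃(μ_p)` = `sahiC3_cube_five`) only the quadruples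
co-generated by the 4-coloured antichains of the `5`-cube matter (`Σ_N 4^{|N|} = 31 346 385`); up to relabelling of the colours (`E₄` is
symmetric) `1 384 548` leaves remain, of which `703 905` use all four colours and take prim-masterthm-p3's four-copy tensor-Bernstein digit
test (the others have a member `= Ω` and `E₄ = 2E₃ ≥ 0`).  `colourCheck4 5 26` (…`SahiC4CubeColourCheck`) runs exactly these; it is evaluated in
six chunks split along the skip chain of its recursion and glued here (`colourCheck4_five`); `sahiE4_nonneg_of_colourCheck4`
(…`SahiC4CubeColourEvents`) is its kernel-checked soundness.  The same `703 905` co-generated quadruples (all `1 384 548` classes) were found to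
pass outside Lean by two independent programs (typer gen 27: C four-copy fibre sums `kahncube4.c`, kit j168961/j168962; Python order-4
Kronecker engine, kit j169071–j169085).

* `colourCheck4_five` — the check passes at `m = 5`, base `2^26` (assembly of the chunks);
* **`sahiC4_cube_five`** — `C₄` on `{0,1}^5` for every product measure (increasing events);
* `sahiPositive_bernoulliWeight_four_fin_five` — the function form `SahiPositive (bernoulliWeight p) 4` on `Set (Fin 5)`;
* `sahiPositive_bernoulliWeight_fin_five_of_le_four` — `SahiPositive (bernoulliWeight p) n` for every `n ≤ 4` on five coins. [this work]
-/

namespace Summit.CriticalPhenomena.PercolationContinuityZ3.Theorems.SahiC4Cube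

open SahiC3Cube Literature.Combinatorics.Sahi2008
open Literature.Probability.LatticeModels (prodBernoulli sahiE4)

/-- **The 4-coloured-antichain check passes in dimension `5`** (base `2^26`), assembled from the computational chunks along the skip chain:
first points `3` and `7` through their depth-two branch terms (chunks A1/A2, B1/B2), first points `5, 11` (chunk C), the rest (chunk D). [this work] -/
theorem colourCheck4_five : colourCheck4 5 26 = true := by
  refine colourCheck4_of_brTop (by norm_num) (by norm_num) (fun q hq => ?_)
  have ha2 := List.all_eq_true.1 colour4Chunk_five_a2
  have hb2 := List.all_eq_true.1 colour4Chunk_five_b2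
  have hc := List.all_eq_true.1 colour4Chunk_five_c
  have hd := List.all_eq_true.1 colour4Chunk_five_d
  by_cases h3 : q = 3
  · subst h3
    refine brTop_of_brSnd (by norm_num) (fun q'' h1 h2 hcone => ?_)
    by_cases h5 : q'' = 5
    · subst h5
      exact brSnd_of_sndCol colour4Chunk_five_a2s colour4Chunk_five_a1
    · refine ha2 q'' (List.mem_filter.2 ⟨List.mem_range.2 h2, ?_⟩)
      have hc' : (coneN 5 3).testBit q'' = false := by simpa using hcone
      simp [h1, h5, hc']
  by_cases h7 : q = 7
  · subst h7
    refine brTop_of_brSnd (by norm_num) (fun q'' h1 h2 hcone => ?_)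
    by_cases h11 : q'' = 11
    · subst h11
      exact brSnd_of_sndCol colour4Chunk_five_b2s colour4Chunk_five_b1
    · refine hb2 q'' (List.mem_filter.2 ⟨List.mem_range.2 h2, ?_⟩)
      have hc' : (coneN 5 7).testBit q'' = false := by simpa using hcone
      simp [h1, h11, hc']
  by_cases h511 : q ∈ ([5, 11] : List ℕ)
  · exact hc q h511
  · refine hd q (List.mem_filter.2 ⟨List.mem_range.2 hq, ?_⟩)
    simp only [List.mem_cons, List.not_mem_nil, or_false, not_or] at h511
    obtain ⟨h5, h11⟩ := h511
    simp [h3, h5, h7, h11]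

/-- **Sahi's `C₄` on `{0,1}⁵` for every product measure**: for `p : Fin 5 → [0,1]` and increasing `A, B, C, D ⊆ Set (Fin 5)`,
`0 ≤ E₄(A,B,C,D)` under `prodBernoulli p` (computational closure through the chunks and `sahiC3_cube_five`). [this work] -/
theorem sahiC4_cube_five (p : Fin 5 → unitInterval) {A B C D : Set (Set (Fin 5))} (hA : IsUpperSet A) (hB : IsUpperSet B)
    (hC : IsUpperSet C) (hD : IsUpperSet D) : 0 ≤ sahiE4 (prodBernoulli p) A B C D :=
  sahiE4_nonneg_of_colourCheck4 colourCheck4_five p (fun hX hY hZ => sahiC3_cube_five p hX hY hZ) hA hB hC hD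

/-- **Order-`4` Sahi positivity of every product weight on `2^{Fin 5}`, function form** (all nonnegative increasing `f₁, …, f₄`). [this work] -/
theorem sahiPositive_bernoulliWeight_four_fin_five (p : Fin 5 → unitInterval) : SahiPositive (bernoulliWeight p) 4 :=
  sahiPositive_four_of_colourCheck4 colourCheck4_five p (fun hX hY hZ => sahiC3_cube_five p hX hY hZ)

/-- `C_n(μ_p)` on five coins for every `n ≤ 4`. [this work] -/
theorem sahiPositive_bernoulliWeight_fin_five_of_le_four (p : Fin 5 → unitInterval) {n : ℕ} (hn : n ≤ 4) :
    SahiPositive (bernoulliWeight p) n := by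
  interval_cases n
  · exact sahiPositive_zero _
  · exact sahiPositive_one (isFKGMeasure_bernoulliWeight p).nonneg
  · exact sahiPositive_two (isFKGMeasure_bernoulliWeight p)
  · exact sahiPositive_three_of_events p (fun hX hY hZ => sahiC3_cube_five p hX hY hZ)
  · exact sahiPositive_bernoulliWeight_four_fin_five p

end Summit.CriticalPhenomena.PercolationContinuityZ3.Theorems.SahiC4Cube
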